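import Literature.MathematicalPhysics.QuantumFieldTheory.Balaban1983to89.B4Strip

/-!
# `Balaban1983to89.B4StripCauchy` — the j-uniform complex strip of B4 p. 586 is a THEOREM:
# `B4Strip.UniformImLipschitz` and `B4Strip.UniformStrip` proved (Cauchy's Estimate on coordinate discs)

T. Bałaban, *Regularity and decay of lattice Green's functions*, Commun. Math. Phys. **89**, 571–597 (1983)
[Balaban1983RegularityDecay] (cell paper B4), p. 586 [PDF 16], l. 9–11.

CITATION HEADER (lean-in-tree rule 2026-08-18).  This module is a SUPPLEMENT to the sibling modules `…Balaban1983to89.B4`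
(typed skeleton; leaf `B4.Lemma24Printed` = Lemma 2.4 (2.35)–(2.37), p. 582) and `…Balaban1983to89.B4Strip` (imported; the
continued momentum symbols `S1`, `Sxi`, `DeltaXi`, `uFactor`, `U`, the regrouped denominator `E`, the strip `Strip d κ`, real
positivity `E_re_ge`, the architecture `strip_lower_bound` / `E_lower_of_ImLipschitz`, and the typed statements `UniformStrip`,
`UniformImLipschitz` with the reduction `uniformStrip_of_uniformImLipschitz`).  It is NOT a quotation of the paper.  B4 bounds
the integrand of (2.43)–(2.49) for REAL momenta ((2.50)–(2.51), p. 586 l. 1–8) and then ASSERTS, without proof (p. 586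
l. 9–11, verbatim): "The expression is a function of p′ and can be extended as an analytic function to some neighbourhood of
[−π,π]^d.  It is more troublesome, but equally elementary, to prove that this neighbourhood can be chosen independently of j
and that the expression is bounded also in this neighbourhood."  (audit census G-B4-02 / G-B4-02a / G-B4-02c; the same
sentence is inherited by B5 Prop. 1.2, CMP 95:17, p. 22, census G-B5-06a(b), and by B6 Prop. 2.5.)  The cell `pub-balaban`
SUPPLIED the missing proof in prose (`HOME/b2b-balaban-b04-g2/StripLemma.md`, Lemma A (A1)–(A7) + Lemma C (C1)–(C3),
cross-read C-pv10-1/2/3/9), and `B4Strip` typed its conclusion as the Prop `UniformStrip` reduced to the single analytic leaf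
`UniformImLipschitz`.  THIS FILE DISCHARGES THAT LEAF IN THE KERNEL: `uniformImLipschitz_holds`, hence `uniformStrip_holds :
0 < a₋ → UniformStrip d a₋ a₊ m²₊` and the explicit-constant form `uniformStrip_explicit` — for every dimension `d`, every
coupling window `0 < a₋ ≤ a ≤ a₊`, every mass window `0 ≤ m² ≤ m²₊`, uniformly in the block size `n = L^j ≥ 1`.
Inputs: the definitions of `B4Strip` (= the displayed formulas (2.44)–(2.49), p. 584–585, taken as DEFINITIONS), Mathlib's
Cauchy estimate `Complex.norm_deriv_le_of_forall_mem_sphere_norm_le` (the kernel form of [Conway, *Functions of One Complex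
Variable I*, GTM 11 (1978), IV.2.14 p. 73], the only external theorem StripLemma.md invokes), the mean-value inequality
`Convex.norm_image_sub_le_of_norm_deriv_le`, the Chebyshev identity `Polynomial.Chebyshev.U_complex_cos` (removable singularity
of `ρ_n = S₁/S_ξ`), `hasSum_zeta_two` (the residue sums), and calculus.  NO published theorem is used as a hypothesis, NO
statement of the series is asserted, no `…Printed` Prop of the sibling modules is used.  No `sorry`, no axiom, no `opaque`.

Contents (StripLemma.md locators in brackets):
 * §1 ABSTRACT LEMMA C [(C1)–(C3)]: for any `g : ℂ^d → ℂ`, slice-holomorphy at the points of the FAT REGION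
   `F_r = {|Re q_ν| ≤ π + r, |Im q_ν| ≤ 2r}` and `|g| ≤ M` on `F_r` give `|∂g/∂q_μ| ≤ M/r` on every strip `|Im q_ν| ≤ κ ≤ r`
   (Cauchy's Estimate on the coordinate disc of radius `r`, `norm_deriv_slice_le`), hence by the mean-value inequality on
   the convex coordinate box and telescoping over `μ` (`one_coordinate_step`, `telescope`) the imaginary-direction Lipschitz
   bound `|g(p) − g(Re p)| ≤ (M/r) Σ_μ |Im p_μ|` (`imLipschitz_of_fat`).
 * §2 one-variable trigonometry, uniform in `n` [(A1)–(A3)]: `S_ξ(z) = 4n² sin²(z/2n)`, `|S_ξ(x+iy)| = 4n²(sin²(x/2n) +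
   sinh²(y/2n))`, hence on `|y| ≤ 1`: `|S_ξ| ≤ x² + (25/16)y²`, `Re S_ξ ≥ 4n² sin²(x/2n) − (25/16)y²`, and for `|x| ≤ πn`:
   `|S_ξ| ≥ (4/π²)x² + y²` (Jordan, from `B4Strip.S1r_ge`); `S_ξ(z) ≠ 0` for `0 ≠ z`, `|Re z| < 2π`.
 * §3 the factors on the fat box `r ≤ 1/4` [(A4)–(A6)]: `|S₁|, |S_ξ| ≤ 16`; `|ρ_n| ≤ 4` (filled factor, `n = 1` and `n ≥ 2`
   separately); for the shifted residues `1 ≤ j ≤ n−1`: `|S_ξ(z+2πj)| ≥ 3`, `Re S_ξ(z+2πj) ≥ 3 − (25/16)(Im z)²` and the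
   quadratic decay `1/|S_ξ(z+2πj)| ≤ 2/(j+1)² + 2/(n−j)²`, whence `Σ_{j ∈ ℤ_n} |u_n(j;z)| ≤ 4 + 64·(Σ 1/i²) ≤ 132`
   (`sum_norm_uFactor_le`) — all independent of `n`.
 * §4 on `F_r` with `r ≤ 1/4`, `d r² ≤ 1/16` [(A5)–(A7)]: `|Δ^ξ+m²| ≤ 16d + m²`, `Re(Δ^ξ+m²)(q + 2πk) ≥ 2` for `k ≠ 0` (the
   shifted denominators have no zero on the fat region), `Σ_k |u_n(k;q)| ≤ 132^d` (`Finset.prod_univ_sum`), and the bound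
   `|E(q)| ≤ M_E := (16d+|m²₊|) + A·4^d + A·(16d+|m²₊|)/2·132^d`, `A = max(|a₋|,|a₊|)` (`norm_E_le`, `boundM`).
 * §5 hypothesis (H1) [(A3),(A5)]: every coordinate slice of `E` through a point of `F_r` is holomorphic there
   (`differentiableAt_E_slice`; the filled factor `ρ_n` is identified with the entire function `U_{n−1}(cos(z/2n))²/n²` on the
   open set `|Re z| < 2π`, `uFactor_zero_eq_cheb`).
 * §6 the constants `r = 1/(4(d+1))`, `Λ = M_E/r` and the theorems `uniformImLipschitz_holds`, `uniformStrip_holds`,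
   `uniformStrip_explicit` (`κ₀ = min(r, c/(Λd+1))`, `c = a₋(4/π²)^d/2`).
CONSTANTS DIFFER from StripLemma.md §5 (there `r = 1/(2√d)`, `σ = (π+r)² + 4 sinh² r`, `ρ₊ = π²/4`, sharper residue sums):
here cruder rational constants are chosen for kernel convenience (DIVERGENCE D-b04g3-1 in the cell records; immaterial — the
printed claim and `UniformStrip` are existential in `κ, c`).  VALUE: kernel certificate of a cell-supplied proof of a located,
unprinted, load-bearing step of B4 (and of B5 Prop. 1.2 / B6 Prop. 2.5 by inheritance); it is NOT a result of the paper and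
NOT progress on any summit.  Unit `b2b-balaban-b04-g3` (paper sub-cell B04, gen 3).  Staged byte-identically in the cell package
`run/shared/lean/pub/pub-balaban/lean/BalabanYm4/Literature/MathematicalPhysics/QuantumFieldTheory/Balaban1983to89/B4StripCauchy.lean`.
Companion records: StripLemma.md (prose proof, gen 2), GAPS.md rows G-B4-02a/02c (kernel upgrade, this unit), DIVERGENCE D-b04g3-1.
-/

namespace Literature.MathematicalPhysics.QuantumFieldTheory.Balaban1983to89.B4StripCauchy

open Complex Finset Metric
open Literature.MathematicalPhysics.QuantumFieldTheory.Balaban1983to89.B4Strip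

noncomputable section

variable {d : ℕ}

/-! ### §1 Abstract part: Cauchy's Estimate on coordinate discs + mean value + telescoping -/

/-- the FAT REGION `F_r = {q ∈ ℂ^d : |Re q_ν| ≤ π + r, |Im q_ν| ≤ 2r}` carrying the coordinate discs of radius `r`
about the points of every strip of half-width `κ ≤ r` (StripLemma.md Lemma C (C1)). [folklore] -/
def Fat (d : ℕ) (r : ℝ) : Set (Fin d → ℂ) :=
  {q | ∀ ν, |(q ν).re| ≤ Real.pi + r ∧ |(q ν).im| ≤ 2 * r}

/-- the closed coordinate box of the strip of half-width `κ`. [folklore] -/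
def Box (κ : ℝ) : Set ℂ := {z | |z.re| ≤ Real.pi ∧ |z.im| ≤ κ}

/-- every strip of half-width `κ ≤ r` lies in the fat region `F_r`. [folklore] -/
theorem strip_subset_fat {r κ : ℝ} (hr : 0 ≤ r) (hκ : κ ≤ r) : Strip d κ ⊆ Fat d r := by
  intro q hq ν
  obtain ⟨h1, h2⟩ := hq ν
  exact ⟨by linarith, by linarith⟩

/-- a strip point with one coordinate moved inside its closed coordinate disc of radius `r` is fat. [folklore] -/
theorem update_mem_fat {r κ : ℝ} (hr : 0 ≤ r) (hκ : κ ≤ r) {q : Fin d → ℂ} (hq : q ∈ Strip d κ)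
    (μ : Fin d) {w : ℂ} (hw : w ∈ closedBall (q μ) r) : Function.update q μ w ∈ Fat d r := by
  intro ν
  by_cases h : ν = μ
  · subst h
    simp only [Function.update_self]
    rw [mem_closedBall, dist_eq_norm] at hw
    have hre : |(w - q ν).re| ≤ ‖w - q ν‖ := abs_re_le_norm _
    have him : |(w - q ν).im| ≤ ‖w - q ν‖ := abs_im_le_norm _
    obtain ⟨h1, h2⟩ := hq ν
    simp only [sub_re, sub_im] at hre him
    have e1 := abs_sub_abs_le_abs_sub w.re (q ν).re
    have e2 := abs_sub_abs_le_abs_sub w.im (q ν).im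
    exact ⟨by linarith, by linarith⟩
  · simp only [Function.update_of_ne h]
    obtain ⟨h1, h2⟩ := hq ν
    exact ⟨by linarith, by linarith⟩

/-- moving one coordinate of a strip point inside the closed coordinate box keeps it in the strip. [folklore] -/
theorem update_mem_strip {κ : ℝ} {q : Fin d → ℂ} (hq : q ∈ Strip d κ) (μ : Fin d) {z : ℂ}
    (hz : z ∈ Box κ) : Function.update q μ z ∈ Strip d κ := by
  intro ν
  by_cases h : ν = μ
  · subst h; simp only [Function.update_self]; exact hz
  · simp only [Function.update_of_ne h]; exact hq ν

/-- the closed coordinate box `|Re z| ≤ π, |Im z| ≤ κ` is convex. [folklore] -/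
theorem convex_box (κ : ℝ) : Convex ℝ (Box κ) := by
  have : Box κ = ({z : ℂ | -Real.pi ≤ z.re} ∩ {z : ℂ | z.re ≤ Real.pi}) ∩
      ({z : ℂ | -κ ≤ z.im} ∩ {z : ℂ | z.im ≤ κ}) := by
    ext z; simp only [Box, Set.mem_setOf_eq, Set.mem_inter_iff, abs_le]
  rw [this]
  exact ((convex_halfSpace_re_ge _).inter (convex_halfSpace_re_le _)).inter
    ((convex_halfSpace_im_ge _).inter (convex_halfSpace_im_le _))

/-- CAUCHY'S ESTIMATE for the coordinate slices (Conway I, IV.2.14 — here Mathlib's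
`Complex.norm_deriv_le_of_forall_mem_sphere_norm_le`): slice-holomorphy on the fat region and `|g| ≤ M` there give
`|∂g/∂z_μ| ≤ M/r` at every point of every strip of half-width `κ ≤ r` (StripLemma.md (C1)). [folklore] -/
theorem norm_deriv_slice_le (g : (Fin d → ℂ) → ℂ) {r M κ : ℝ} (hr : 0 < r) (hκ : κ ≤ r)
    (hdiff : ∀ q ∈ Fat d r, ∀ μ, DifferentiableAt ℂ (fun w => g (Function.update q μ w)) (q μ))
    (hbound : ∀ q ∈ Fat d r, ‖g q‖ ≤ M)
    {q : Fin d → ℂ} (hq : q ∈ Strip d κ) (μ : Fin d) :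
    ‖deriv (fun w => g (Function.update q μ w)) (q μ)‖ ≤ M / r := by
  apply Complex.norm_deriv_le_of_forall_mem_sphere_norm_le hr
  · refine DifferentiableOn.diffContOnCl_ball ?_ (subset_refl (closedBall (q μ) r))
    intro w hw
    have hq' : Function.update q μ w ∈ Fat d r := update_mem_fat hr.le hκ hq μ hw
    have := hdiff _ hq' μ
    simp only [Function.update_idem, Function.update_self] at this
    exact this.differentiableWithinAt
  · intro w hw
    exact hbound _ (update_mem_fat hr.le hκ hq μ (sphere_subset_closedBall hw))

/-- ONE COORDINATE (StripLemma.md (C2), one segment): `|g(q) − g(q with q_μ ↦ Re q_μ)| ≤ (M/r)|Im q_μ|`. [folklore] -/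
theorem one_coordinate_step (g : (Fin d → ℂ) → ℂ) {r M κ : ℝ} (hr : 0 < r) (hκ0 : 0 ≤ κ) (hκ : κ ≤ r)
    (hdiff : ∀ q ∈ Fat d r, ∀ μ, DifferentiableAt ℂ (fun w => g (Function.update q μ w)) (q μ))
    (hbound : ∀ q ∈ Fat d r, ‖g q‖ ≤ M)
    {q : Fin d → ℂ} (hq : q ∈ Strip d κ) (μ : Fin d) :
    ‖g q - g (Function.update q μ (((q μ).re : ℝ) : ℂ))‖ ≤ M / r * |(q μ).im| := by
  set f : ℂ → ℂ := fun w => g (Function.update q μ w) with hf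
  have hderiv : ∀ z ∈ Box κ, ‖deriv f z‖ ≤ M / r := by
    intro z hz
    have hqz : Function.update q μ z ∈ Strip d κ := update_mem_strip hq μ hz
    have := norm_deriv_slice_le g hr hκ hdiff hbound hqz μ
    simp only [Function.update_idem, Function.update_self] at this
    exact this
  have hdiffz : ∀ z ∈ Box κ, DifferentiableAt ℂ f z := by
    intro z hz
    have hqz : Function.update q μ z ∈ Strip d κ := update_mem_strip hq μ hz
    have := hdiff _ (strip_subset_fat hr.le hκ hqz) μ
    simp only [Function.update_idem, Function.update_self] at this
    exact this
  have hx : (((q μ).re : ℝ) : ℂ) ∈ Box κ := by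
    refine ⟨?_, ?_⟩
    · simp only [ofReal_re]; exact (hq μ).1
    · simp only [ofReal_im, abs_zero]; exact hκ0
  have hy : q μ ∈ Box κ := hq μ
  have key := (convex_box κ).norm_image_sub_le_of_norm_deriv_le hdiffz hderiv hx hy
  have h1 : f (q μ) = g q := by simp [hf]
  have h2 : ‖q μ - (((q μ).re : ℝ) : ℂ)‖ = |(q μ).im| := by
    have : q μ - (((q μ).re : ℝ) : ℂ) = (((q μ).im : ℝ) : ℂ) * I := by
      apply Complex.ext <;> simp
    rw [this, norm_mul, Complex.norm_I, mul_one, Complex.norm_real, Real.norm_eq_abs]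
  rw [h1, h2] at key
  exact key

/-- replace the coordinates in `s` by their real parts. [folklore] -/
def realify (s : Finset (Fin d)) (p : Fin d → ℂ) : Fin d → ℂ :=
  fun ν => if ν ∈ s then (((p ν).re : ℝ) : ℂ) else p ν

/-- `realify ∅ = id`. [folklore] -/
theorem realify_empty (p : Fin d → ℂ) : realify ∅ p = p := by
  funext ν; simp [realify]

/-- `realify univ p = Re p` (as a complex vector). [folklore] -/
theorem realify_univ (p : Fin d → ℂ) : realify Finset.univ p = ofRealVec (reVec p) := by
  funext ν; simp [realify, ofRealVec, reVec]

/-- coordinates outside `s` are untouched by `realify s`. [folklore] -/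
theorem realify_apply_of_not_mem {s : Finset (Fin d)} {μ : Fin d} (h : μ ∉ s) (p : Fin d → ℂ) :
    realify s p μ = p μ := by simp [realify, h]

/-- `realify (insert μ s)` = `realify s` followed by replacing coordinate `μ` by its real part. [folklore] -/
theorem realify_insert (s : Finset (Fin d)) (μ : Fin d) (p : Fin d → ℂ) :
    realify (insert μ s) p = Function.update (realify s p) μ ((((realify s p) μ).re : ℝ) : ℂ) := by
  funext ν
  by_cases h : ν = μ
  · subst h
    simp only [realify, Function.update_self, Finset.mem_insert, true_or, if_true]
    by_cases h' : ν ∈ s <;> simp [h']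
  · simp only [realify, Function.update_of_ne h, Finset.mem_insert, h, false_or]

/-- `realify s` maps the strip of half-width `κ ≥ 0` into itself. [folklore] -/
theorem realify_mem_strip {κ : ℝ} (hκ : 0 ≤ κ) {p : Fin d → ℂ} (hp : p ∈ Strip d κ) (s : Finset (Fin d)) :
    realify s p ∈ Strip d κ := by
  intro ν
  by_cases h : ν ∈ s
  · simp only [realify, h, if_true, ofReal_re, ofReal_im, abs_zero]
    exact ⟨(hp ν).1, hκ⟩
  · simp only [realify, h, if_false]; exact hp ν

/-- TELESCOPING over the coordinates (StripLemma.md (C2), the sum over μ). [folklore] -/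
theorem telescope (g : (Fin d → ℂ) → ℂ) {r M κ : ℝ} (hr : 0 < r) (hκ0 : 0 ≤ κ) (hκ : κ ≤ r)
    (hdiff : ∀ q ∈ Fat d r, ∀ μ, DifferentiableAt ℂ (fun w => g (Function.update q μ w)) (q μ))
    (hbound : ∀ q ∈ Fat d r, ‖g q‖ ≤ M)
    {p : Fin d → ℂ} (hp : p ∈ Strip d κ) (s : Finset (Fin d)) :
    ‖g p - g (realify s p)‖ ≤ M / r * ∑ μ ∈ s, |(p μ).im| := by
  induction s using Finset.induction_on with
  | empty => simp [realify_empty]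
  | insert μ s hμ ih =>
    have hq : realify s p ∈ Strip d κ := realify_mem_strip hκ0 hp s
    have step := one_coordinate_step g hr hκ0 hκ hdiff hbound hq μ
    rw [realify_apply_of_not_mem hμ] at step
    rw [realify_insert, realify_apply_of_not_mem hμ, Finset.sum_insert hμ]
    calc ‖g p - g (Function.update (realify s p) μ (((p μ).re : ℝ) : ℂ))‖
        ≤ ‖g p - g (realify s p)‖
          + ‖g (realify s p) - g (Function.update (realify s p) μ (((p μ).re : ℝ) : ℂ))‖ :=
          norm_sub_le_norm_sub_add_norm_sub _ _ _
      _ ≤ M / r * ∑ x ∈ s, |(p x).im| + M / r * |(p μ).im| := add_le_add ih step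
      _ = M / r * (|(p μ).im| + ∑ x ∈ s, |(p x).im|) := by ring

/-- THE ABSTRACT LIPSCHITZ LEMMA (StripLemma.md Lemma C): slice-holomorphy and the bound `M` on the fat region `F_r`
give the imaginary-direction Lipschitz bound with constant `M/r` on every strip of half-width `0 ≤ κ ≤ r`. [folklore] -/
theorem imLipschitz_of_fat (g : (Fin d → ℂ) → ℂ) {r M κ : ℝ} (hr : 0 < r) (hκ0 : 0 ≤ κ) (hκ : κ ≤ r)
    (hdiff : ∀ q ∈ Fat d r, ∀ μ, DifferentiableAt ℂ (fun w => g (Function.update q μ w)) (q μ))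
    (hbound : ∀ q ∈ Fat d r, ‖g q‖ ≤ M) :
    ∀ p ∈ Strip d κ, ‖g p - g (ofRealVec (reVec p))‖ ≤ M / r * ∑ μ, |(p μ).im| := by
  intro p hp
  have := telescope g hr hκ0 hκ hdiff hbound hp Finset.univ
  rwa [realify_univ] at this

/-! ### §2 Elementary complex trigonometry, uniform in `n` (StripLemma.md Lemma A (A1)–(A3)) -/

/-- `Re sin(u+iv) = sin u cosh v`. [folklore] -/
private theorem sin_re' (w : ℂ) : (Complex.sin w).re = Real.sin w.re * Real.cosh w.im := by
  rw [Complex.sin_eq]; simp [← ofReal_sin, ← ofReal_cosh, ← ofReal_cos, ← ofReal_sinh]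

/-- `Im sin(u+iv) = cos u sinh v`. [folklore] -/
private theorem sin_im' (w : ℂ) : (Complex.sin w).im = Real.cos w.re * Real.sinh w.im := by
  rw [Complex.sin_eq]; simp [← ofReal_sin, ← ofReal_cosh, ← ofReal_cos, ← ofReal_sinh]

/-- `|sin(u+iv)|² = sin²u + sinh²v`. [folklore] -/
private theorem norm_sin_sq (w : ℂ) : ‖Complex.sin w‖ ^ 2 = Real.sin w.re ^ 2 + Real.sinh w.im ^ 2 := by
  rw [Complex.sq_norm, Complex.normSq_apply, sin_re', sin_im']
  have h1 := Real.cosh_sq w.im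
  have h2 := Real.sin_sq_add_cos_sq w.re
  linear_combination (Real.sin w.re ^ 2) * h1 + (Real.sinh w.im ^ 2) * h2

/-- `Re sin²(u+iv) = sin²u·cosh²v − cos²u·sinh²v ≥ sin²u − sinh²v`. [folklore] -/
theorem sin_sq_re_ge (w : ℂ) : Real.sin w.re ^ 2 - Real.sinh w.im ^ 2 ≤ (Complex.sin w ^ 2).re := by
  have e : (Complex.sin w ^ 2).re = (Complex.sin w).re ^ 2 - (Complex.sin w).im ^ 2 := by
    rw [sq, Complex.mul_re]; ring
  rw [e, sin_re', sin_im']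
  have h1 : 1 ≤ Real.cosh w.im := Real.one_le_cosh w.im
  have h2 : Real.cos w.re ^ 2 ≤ 1 := Real.cos_sq_le_one w.re
  have h3 : 0 ≤ Real.sin w.re ^ 2 := sq_nonneg _
  have h4 : 0 ≤ Real.sinh w.im ^ 2 := sq_nonneg _
  have h5 : 1 ≤ Real.cosh w.im ^ 2 := by nlinarith
  nlinarith

/-- the only zero of `sin` with `|Re w| < π` is `w = 0`. [folklore] -/
theorem sin_ne_zero_of_abs_re_lt {w : ℂ} (hw : |w.re| < Real.pi) (h0 : w ≠ 0) : Complex.sin w ≠ 0 := by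
  intro h
  have h2 : Real.sin w.re ^ 2 + Real.sinh w.im ^ 2 = 0 := by rw [← norm_sin_sq, h, norm_zero]; ring
  have hs : Real.sin w.re ^ 2 = 0 := by nlinarith [sq_nonneg (Real.sin w.re), sq_nonneg (Real.sinh w.im)]
  have hsh : Real.sinh w.im ^ 2 = 0 := by nlinarith [sq_nonneg (Real.sin w.re), sq_nonneg (Real.sinh w.im)]
  have hs' : Real.sin w.re = 0 := pow_eq_zero_iff (two_ne_zero) |>.mp hs
  have hsh' : Real.sinh w.im = 0 := pow_eq_zero_iff (two_ne_zero) |>.mp hsh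
  have hre : w.re = 0 :=
    (Real.sin_eq_zero_iff_of_lt_of_lt (by linarith [(abs_lt.mp hw).1]) (abs_lt.mp hw).2).mp hs'
  have him : w.im = 0 := Real.sinh_eq_zero.mp hsh'
  exact h0 (Complex.ext (by simpa using hre) (by simpa using him))

/-- `sinh t ≤ t + t²/2` on `[0,1]` (from `e^t ≤ 1 + t + t²`, `e^{−t} ≥ 1 − t`). [folklore] -/
theorem sinh_le_of_le_one {t : ℝ} (h0 : 0 ≤ t) (h1 : t ≤ 1) : Real.sinh t ≤ t + t ^ 2 / 2 := by
  rw [Real.sinh_eq]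
  have e1 : Real.exp t ≤ 1 + t + t ^ 2 := by
    have h := Real.abs_exp_sub_one_sub_id_le (x := t) (by rw [abs_of_nonneg h0]; exact h1)
    have := (abs_le.mp h).2; linarith
  have e2 : 1 - t ≤ Real.exp (-t) := by have := Real.add_one_le_exp (-t); linarith
  linarith

/-- `sinh² v ≤ (25/16) v²` for `|v| ≤ 1/2`. [folklore] -/
theorem sinh_sq_le {v : ℝ} (hv : |v| ≤ 1 / 2) : Real.sinh v ^ 2 ≤ 25 / 16 * v ^ 2 := by
  have h0 : 0 ≤ |v| := abs_nonneg v
  have hs : Real.sinh |v| ≤ 5 / 4 * |v| := by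
    have := sinh_le_of_le_one h0 (by linarith)
    nlinarith
  have hs0 : 0 ≤ Real.sinh |v| := Real.sinh_nonneg_iff.mpr h0
  have e : Real.sinh v ^ 2 = Real.sinh |v| ^ 2 := by rw [← Real.abs_sinh, sq_abs]
  rw [e, ← sq_abs v]
  nlinarith

/-- `v² ≤ sinh² v`. [folklore] -/
private theorem sq_le_sinh_sq (v : ℝ) : v ^ 2 ≤ Real.sinh v ^ 2 := by
  have h : |v| ≤ Real.sinh |v| := Real.self_le_sinh_iff.mpr (abs_nonneg v)
  rw [← Real.abs_sinh] at h
  rw [← sq_abs v, ← sq_abs (Real.sinh v)]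
  exact pow_le_pow_left₀ (abs_nonneg v) h 2

/-- Jordan squared: `(4/π²) u² ≤ sin² u` for `|u| ≤ π/2` (from `B4Strip.S1r_ge`). [folklore] -/
theorem jordan_sq {u : ℝ} (hu : |u| ≤ Real.pi / 2) : 4 / Real.pi ^ 2 * u ^ 2 ≤ Real.sin u ^ 2 := by
  have h := S1r_ge (2 * u) (by rw [abs_mul, abs_two]; linarith)
  rw [S1r_eq, show 2 * u / 2 = u by ring] at h
  have hπ : 0 < Real.pi ^ 2 := by positivity
  rw [div_le_iff₀ hπ] at h
  rw [div_mul_eq_mul_div, div_le_iff₀ hπ]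
  nlinarith

/-- `sin θ ≥ (2/π)·θ'` where `θ' = θ` on `[0, π/2]` — scaled: `0 ≤ t ≤ πN ⇒ (4/π²) t² ≤ 4N² sin²(t/2N)`. [folklore] -/
theorem scaled_jordan {N t : ℝ} (hN : 0 < N) (h0 : 0 ≤ t) (h1 : t ≤ Real.pi * N) :
    4 / Real.pi ^ 2 * t ^ 2 ≤ 4 * N ^ 2 * Real.sin (t / (2 * N)) ^ 2 := by
  have hu : |t / (2 * N)| ≤ Real.pi / 2 := by
    rw [abs_div, abs_of_nonneg h0, abs_of_pos (by positivity : (0:ℝ) < 2 * N), div_le_iff₀ (by positivity)]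
    nlinarith
  have h := jordan_sq hu
  have e : 4 * N ^ 2 * (4 / Real.pi ^ 2 * (t / (2 * N)) ^ 2) = 4 / Real.pi ^ 2 * t ^ 2 := by
    field_simp; ring
  have := mul_le_mul_of_nonneg_left h (by positivity : (0:ℝ) ≤ 4 * N ^ 2)
  rw [e] at this
  exact this

/-- reflected: `πN ≤ t ≤ 2πN ⇒ (4/π²)(2πN − t)² ≤ 4N² sin²(t/2N)`. [folklore] -/
theorem scaled_jordan' {N t : ℝ} (hN : 0 < N) (h0 : Real.pi * N ≤ t) (h1 : t ≤ 2 * Real.pi * N) :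
    4 / Real.pi ^ 2 * (2 * Real.pi * N - t) ^ 2 ≤ 4 * N ^ 2 * Real.sin (t / (2 * N)) ^ 2 := by
  have h := scaled_jordan hN (t := 2 * Real.pi * N - t) (by linarith) (by linarith)
  have e : Real.sin ((2 * Real.pi * N - t) / (2 * N)) = Real.sin (t / (2 * N)) := by
    rw [show (2 * Real.pi * N - t) / (2 * N) = Real.pi - t / (2 * N) by field_simp, Real.sin_pi_sub]
  rw [e] at h
  exact h

/-! #### the one-coordinate symbols `S₁`, `S_ξ` on the fat box -/

/-- `S_ξ(z) = 4n² sin²(z/2n)` (complex form of `B4Strip.Sxir_eq`). [folklore] -/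
theorem Sxi_eq_sin_sq (n : ℕ) (hn : n ≠ 0) (z : ℂ) :
    Sxi n z = 4 * (n : ℂ) ^ 2 * Complex.sin (z / (2 * n)) ^ 2 := by
  have hn' : (n : ℂ) ≠ 0 := Nat.cast_ne_zero.mpr hn
  unfold Sxi
  have h1 : Complex.cos (z / n) = 2 * Complex.cos (z / (2 * n)) ^ 2 - 1 := by
    rw [← Complex.cos_two_mul]; congr 1; field_simp
  have h2 := Complex.sin_sq_add_cos_sq (z / (2 * n))
  rw [h1]; linear_combination (-4 * (n : ℂ) ^ 2) * h2

/-- `S₁ = S_ξ` at `n = 1`. [folklore] -/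
theorem S1_eq_Sxi_one (z : ℂ) : S1 z = Sxi 1 z := by simp [S1, Sxi]

/-- `Re (z/2n) = Re z / 2n`. [folklore] -/
theorem re_div_two_nat (z : ℂ) (n : ℕ) : (z / (2 * (n : ℂ))).re = z.re / (2 * n) := by
  rw [show (2 * (n : ℂ)) = ((2 * n : ℝ) : ℂ) by push_cast; ring, Complex.div_ofReal_re]

/-- `Im (z/2n) = Im z / 2n`. [folklore] -/
theorem im_div_two_nat (z : ℂ) (n : ℕ) : (z / (2 * (n : ℂ))).im = z.im / (2 * n) := by
  rw [show (2 * (n : ℂ)) = ((2 * n : ℝ) : ℂ) by push_cast; ring, Complex.div_ofReal_im]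

/-- `|S_ξ(x+iy)| = 4n²(sin²(x/2n) + sinh²(y/2n))`. [folklore] -/
theorem norm_Sxi_eq (n : ℕ) (hn : n ≠ 0) (z : ℂ) :
    ‖Sxi n z‖ = 4 * (n : ℝ) ^ 2 * (Real.sin (z.re / (2 * n)) ^ 2 + Real.sinh (z.im / (2 * n)) ^ 2) := by
  rw [Sxi_eq_sin_sq n hn, norm_mul, norm_pow, norm_sin_sq, re_div_two_nat, im_div_two_nat]
  congr 1
  rw [norm_mul, norm_pow]
  simp

/-- `Re S_ξ(x+iy) ≥ 4n² sin²(x/2n) − (25/16) y²` for `|y| ≤ 1`, all `n ≥ 1` (StripLemma.md (A3)). [folklore] -/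
theorem re_Sxi_ge (n : ℕ) (hn : 1 ≤ n) (z : ℂ) (hy : |z.im| ≤ 1) :
    4 * (n : ℝ) ^ 2 * Real.sin (z.re / (2 * n)) ^ 2 - 25 / 16 * z.im ^ 2 ≤ (Sxi n z).re := by
  have hn0 : n ≠ 0 := by omega
  have hnr : (0 : ℝ) < n := by exact_mod_cast (show 0 < n by omega)
  rw [Sxi_eq_sin_sq n hn0, show (4 * (n : ℂ) ^ 2) = ((4 * (n : ℝ) ^ 2 : ℝ) : ℂ) by push_cast; ring,
    Complex.re_ofReal_mul]
  have h1 := sin_sq_re_ge (z / (2 * n))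
  rw [re_div_two_nat, im_div_two_nat] at h1
  have hn1 : (1 : ℝ) ≤ n := by exact_mod_cast hn
  have hv : |z.im / (2 * n)| ≤ 1 / 2 := by
    rw [abs_div, abs_of_pos (by positivity : (0:ℝ) < 2 * n), div_le_iff₀ (by positivity)]
    nlinarith
  have h2 := sinh_sq_le hv
  have e2 : 4 * (n : ℝ) ^ 2 * (25 / 16 * (z.im / (2 * n)) ^ 2) = 25 / 16 * z.im ^ 2 := by
    field_simp; ring
  have h1' := mul_le_mul_of_nonneg_left h1 (by positivity : (0:ℝ) ≤ 4 * (n : ℝ) ^ 2)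
  have h2' := mul_le_mul_of_nonneg_left h2 (by positivity : (0:ℝ) ≤ 4 * (n : ℝ) ^ 2)
  rw [e2] at h2'
  nlinarith

/-- `|S_ξ(x+iy)| ≥ 4n² sin²(x/2n)`. [folklore] -/
theorem norm_Sxi_ge_sin (n : ℕ) (hn : n ≠ 0) (z : ℂ) :
    4 * (n : ℝ) ^ 2 * Real.sin (z.re / (2 * n)) ^ 2 ≤ ‖Sxi n z‖ := by
  rw [norm_Sxi_eq n hn]
  have : 0 ≤ Real.sinh (z.im / (2 * n)) ^ 2 := sq_nonneg _
  nlinarith [sq_nonneg (n : ℝ)]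

/-- `|S_ξ(x+iy)| ≤ x² + (25/16) y²` for `|y| ≤ 1`, all `n ≥ 1` (StripLemma.md (A1)). [folklore] -/
theorem norm_Sxi_le (n : ℕ) (hn : 1 ≤ n) (z : ℂ) (hy : |z.im| ≤ 1) :
    ‖Sxi n z‖ ≤ z.re ^ 2 + 25 / 16 * z.im ^ 2 := by
  have hn0 : n ≠ 0 := by omega
  have hnr : (0 : ℝ) < n := by exact_mod_cast (show 0 < n by omega)
  rw [norm_Sxi_eq n hn0 z]
  have h1 : Real.sin (z.re / (2 * n)) ^ 2 ≤ (z.re / (2 * n)) ^ 2 := by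
    rw [← sq_abs (Real.sin _), ← sq_abs (z.re / (2 * n))]
    exact pow_le_pow_left₀ (abs_nonneg _) (Real.abs_sin_le_abs) 2
  have hn1 : (1 : ℝ) ≤ n := by exact_mod_cast hn
  have hv : |z.im / (2 * n)| ≤ 1 / 2 := by
    rw [abs_div, abs_of_pos (by positivity : (0:ℝ) < 2 * n), div_le_iff₀ (by positivity)]
    nlinarith
  have h2 := sinh_sq_le hv
  have e1 : 4 * (n : ℝ) ^ 2 * (z.re / (2 * n)) ^ 2 = z.re ^ 2 := by field_simp; ring
  have e2 : 4 * (n : ℝ) ^ 2 * (25 / 16 * (z.im / (2 * n)) ^ 2) = 25 / 16 * z.im ^ 2 := by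
    field_simp; ring
  have h1' := mul_le_mul_of_nonneg_left h1 (by positivity : (0:ℝ) ≤ 4 * (n : ℝ) ^ 2)
  have h2' := mul_le_mul_of_nonneg_left h2 (by positivity : (0:ℝ) ≤ 4 * (n : ℝ) ^ 2)
  rw [e1] at h1'
  rw [e2] at h2'
  nlinarith

/-- `|S_ξ(x+iy)| ≥ (4/π²) x² + y²` when `|x| ≤ πn` (Jordan below + `sinh v ≥ v`; StripLemma.md (A2)). [folklore] -/
theorem norm_Sxi_ge (n : ℕ) (hn : 1 ≤ n) (z : ℂ) (hx : |z.re| ≤ Real.pi * n) :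
    4 / Real.pi ^ 2 * z.re ^ 2 + z.im ^ 2 ≤ ‖Sxi n z‖ := by
  have hn0 : n ≠ 0 := by omega
  have hnr : (0 : ℝ) < n := by exact_mod_cast (show 0 < n by omega)
  rw [norm_Sxi_eq n hn0]
  have hu : |z.re / (2 * n)| ≤ Real.pi / 2 := by
    rw [abs_div, abs_of_pos (by positivity : (0:ℝ) < 2 * n), div_le_iff₀ (by positivity)]
    nlinarith
  have h1 := jordan_sq hu
  have h2 := sq_le_sinh_sq (z.im / (2 * n))
  have e1 : 4 * (n : ℝ) ^ 2 * (4 / Real.pi ^ 2 * (z.re / (2 * n)) ^ 2) = 4 / Real.pi ^ 2 * z.re ^ 2 := by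
    field_simp; ring
  have e2 : 4 * (n : ℝ) ^ 2 * (z.im / (2 * n)) ^ 2 = z.im ^ 2 := by field_simp; ring
  have h1' := mul_le_mul_of_nonneg_left h1 (by positivity : (0:ℝ) ≤ 4 * (n : ℝ) ^ 2)
  have h2' := mul_le_mul_of_nonneg_left h2 (by positivity : (0:ℝ) ≤ 4 * (n : ℝ) ^ 2)
  rw [e1] at h1'
  rw [e2] at h2'
  nlinarith

/-- `S_ξ(z) ≠ 0` for `z ≠ 0` with `|Re z| < 2π`, `n ≥ 1`. [folklore] -/
theorem Sxi_ne_zero (n : ℕ) (hn : 1 ≤ n) {z : ℂ} (hx : |z.re| < 2 * Real.pi) (hz : z ≠ 0) :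
    Sxi n z ≠ 0 := by
  have hn0 : n ≠ 0 := by omega
  have hnr : (1 : ℝ) ≤ n := by exact_mod_cast hn
  rw [Sxi_eq_sin_sq n hn0]
  have hn' : (n : ℂ) ≠ 0 := Nat.cast_ne_zero.mpr hn0
  have hs : Complex.sin (z / (2 * n)) ≠ 0 := by
    apply sin_ne_zero_of_abs_re_lt
    · rw [re_div_two_nat, abs_div, abs_of_pos (by positivity : (0:ℝ) < 2 * n), div_lt_iff₀ (by positivity)]
      nlinarith [Real.pi_pos]
    · intro h
      apply hz
      have : z = (z / (2 * n)) * (2 * n) := by field_simp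
      rw [this, h, zero_mul]
  exact mul_ne_zero (mul_ne_zero (by norm_num) (pow_ne_zero _ hn')) (pow_ne_zero _ hs)

/-! ### §3 The factors of `E` on the fat box `|Re z| ≤ π + r`, `|Im z| ≤ 2r`, `r ≤ 1/4` (StripLemma.md Lemma A (A4)–(A7)) -/

/-- on the fat box with `r ≤ 1/4`: `x² + (25/16)y² ≤ 16` (uses `π < 3.15`). [folklore] -/
theorem sq_fat_le {x y r : ℝ} (hr : r ≤ 1 / 4) (hx : |x| ≤ Real.pi + r) (hy : |y| ≤ 2 * r) :
    x ^ 2 + 25 / 16 * y ^ 2 ≤ 16 := by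
  have hπ := Real.pi_lt_d2
  have hx' : |x| ≤ 3.4 := by linarith
  have hy' : |y| ≤ 1 / 2 := by linarith
  rw [← sq_abs x, ← sq_abs y]
  nlinarith [abs_nonneg x, abs_nonneg y]

/-- `|S_ξ(z)| ≤ 16` on the fat box, all `n ≥ 1` (StripLemma.md (A1), `σ`). [folklore] -/
theorem norm_Sxi_le_16 (n : ℕ) (hn : 1 ≤ n) {z : ℂ} {r : ℝ} (hr : r ≤ 1 / 4)
    (hx : |z.re| ≤ Real.pi + r) (hy : |z.im| ≤ 2 * r) : ‖Sxi n z‖ ≤ 16 :=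
  (norm_Sxi_le n hn z (by linarith)).trans (sq_fat_le hr hx hy)

/-- `|S₁(z)| ≤ 16` on the fat box. [folklore] -/
theorem norm_S1_le_16 {z : ℂ} {r : ℝ} (hr : r ≤ 1 / 4) (hx : |z.re| ≤ Real.pi + r)
    (hy : |z.im| ≤ 2 * r) : ‖S1 z‖ ≤ 16 := by
  rw [S1_eq_Sxi_one]; exact norm_Sxi_le_16 1 le_rfl hr hx hy

/-- the unshifted factor unfolded: `ρ_n(z) = S₁(z)/S_ξ(z)` off `0`, value `1` at `0`. [folklore] -/
theorem uFactor_zero_eq (n : ℕ) (z : ℂ) :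
    uFactor n 0 z = if z = 0 then 1 else S1 z / Sxi n z := by
  simp [uFactor]

/-- the shifted factor unfolded: `u_n(j; z) = S₁(z)/S_ξ(z + 2πj)` for `j ≠ 0`. [folklore] -/
theorem uFactor_ne_eq (n j : ℕ) (hj : j ≠ 0) (z : ℂ) :
    uFactor n j z = S1 z / Sxi n (z + 2 * Real.pi * (j : ℂ)) := by
  simp [uFactor, hj]

/-- `|ρ_n(z)| ≤ 4` on the fat box, uniformly in `n ≥ 1` (StripLemma.md (A4), `ρ₊`). [folklore] -/
theorem norm_uFactor_zero_le (n : ℕ) (hn : 1 ≤ n) {z : ℂ} {r : ℝ} (hr : r ≤ 1 / 4)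
    (hx : |z.re| ≤ Real.pi + r) (hy : |z.im| ≤ 2 * r) : ‖uFactor n 0 z‖ ≤ 4 := by
  rw [uFactor_zero_eq]
  split_ifs with hz
  · simp
  · have hπ := Real.pi_gt_three
    have hπ' := Real.pi_lt_d2
    have hx2 : |z.re| < 2 * Real.pi := by linarith
    rcases eq_or_lt_of_le hn with h1 | h2
    · subst h1
      have hS : Sxi 1 z ≠ 0 := Sxi_ne_zero 1 le_rfl hx2 hz
      rw [S1_eq_Sxi_one, div_self hS]; simp
    · have hn2 : (2:ℝ) ≤ n := by exact_mod_cast h2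
      have hS : Sxi n z ≠ 0 := Sxi_ne_zero n hn hx2 hz
      have hSpos : 0 < ‖Sxi n z‖ := norm_pos_iff.mpr hS
      rw [norm_div, div_le_iff₀ hSpos]
      have hnum : ‖S1 z‖ ≤ z.re ^ 2 + 25 / 16 * z.im ^ 2 := by
        rw [S1_eq_Sxi_one]; exact norm_Sxi_le 1 le_rfl z (by linarith)
      have hden : 4 / Real.pi ^ 2 * z.re ^ 2 + z.im ^ 2 ≤ ‖Sxi n z‖ :=
        norm_Sxi_ge n hn z (by nlinarith)
      have h16 : 1 ≤ 16 / Real.pi ^ 2 := by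
        rw [le_div_iff₀ (by positivity)]; nlinarith
      have h3 : z.re ^ 2 ≤ 4 * (4 / Real.pi ^ 2 * z.re ^ 2) := by
        rw [show 4 * (4 / Real.pi ^ 2 * z.re ^ 2) = z.re ^ 2 * (16 / Real.pi ^ 2) by ring]
        nlinarith [sq_nonneg z.re]
      nlinarith [sq_nonneg z.im]

/-- the shifted symbol, `1 ≤ j ≤ n - 1`, `|x| ≤ π + 1/4`: `4n² sin²((x+2πj)/2n) ≥ 3`, and it is
`≥ (j+1)²/2` or `≥ (n-j)²/2` (StripLemma.md (A5): poles / decay in the residue index). [folklore] -/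
theorem shifted_sin_sq_ge (n j : ℕ) (hj : 1 ≤ j) (hjn : j + 1 ≤ n) {x r : ℝ} (hr : r ≤ 1 / 4)
    (hx : |x| ≤ Real.pi + r) :
    3 ≤ 4 * (n : ℝ) ^ 2 * Real.sin ((x + 2 * Real.pi * j) / (2 * n)) ^ 2 ∧
    (1 / 2 * ((j : ℝ) + 1) ^ 2 ≤ 4 * (n : ℝ) ^ 2 * Real.sin ((x + 2 * Real.pi * j) / (2 * n)) ^ 2 ∨
     1 / 2 * ((n : ℝ) - j) ^ 2 ≤ 4 * (n : ℝ) ^ 2 * Real.sin ((x + 2 * Real.pi * j) / (2 * n)) ^ 2) := by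
  have hπ1 := Real.pi_gt_d2
  have hπ2 := Real.pi_lt_d2
  have hπsq : 0 < Real.pi ^ 2 := by positivity
  have hπ10 : Real.pi ^ 2 ≤ 10 := by nlinarith
  have hπq : 3 * Real.pi ^ 2 ≤ 4 * (Real.pi - 1 / 4) ^ 2 := by nlinarith
  have hjr : (1 : ℝ) ≤ j := by exact_mod_cast hj
  have hjnr : (j : ℝ) + 1 ≤ n := by exact_mod_cast hjn
  have hnpos : (0 : ℝ) < n := by linarith
  have hx' := abs_le.mp hx
  set t := x + 2 * Real.pi * j with ht
  have ht1 : Real.pi - 1 / 4 ≤ t := by nlinarith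
  have ht2 : Real.pi - 1 / 4 ≤ 2 * Real.pi * n - t := by nlinarith
  have htj : 7 / 5 * ((j : ℝ) + 1) ≤ t := by nlinarith
  have htm : 7 / 5 * ((n : ℝ) - j) ≤ 2 * Real.pi * n - t := by nlinarith
  rcases le_total t (Real.pi * n) with h | h
  · have key := scaled_jordan hnpos (by linarith) h
    have hsq : (Real.pi - 1 / 4) ^ 2 ≤ t ^ 2 := pow_le_pow_left₀ (by linarith) ht1 2
    have hsq' : (7 / 5 * ((j : ℝ) + 1)) ^ 2 ≤ t ^ 2 := pow_le_pow_left₀ (by positivity) htj 2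
    have k1 : 3 ≤ 4 / Real.pi ^ 2 * t ^ 2 := by
      rw [div_mul_eq_mul_div, le_div_iff₀ hπsq]; nlinarith
    have k2 : 1 / 2 * ((j : ℝ) + 1) ^ 2 ≤ 4 / Real.pi ^ 2 * t ^ 2 := by
      rw [div_mul_eq_mul_div (4:ℝ), le_div_iff₀ hπsq]
      have := mul_le_mul_of_nonneg_left hπ10 (by positivity : (0:ℝ) ≤ ((j : ℝ) + 1) ^ 2)
      nlinarith
    exact ⟨k1.trans key, Or.inl (k2.trans key)⟩
  · have key := scaled_jordan' hnpos h (by linarith)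
    have hsq : (Real.pi - 1 / 4) ^ 2 ≤ (2 * Real.pi * n - t) ^ 2 := pow_le_pow_left₀ (by linarith) ht2 2
    have hsq' : (7 / 5 * ((n : ℝ) - j)) ^ 2 ≤ (2 * Real.pi * n - t) ^ 2 :=
      pow_le_pow_left₀ (by linarith) htm 2
    have k1 : 3 ≤ 4 / Real.pi ^ 2 * (2 * Real.pi * n - t) ^ 2 := by
      rw [div_mul_eq_mul_div, le_div_iff₀ hπsq]; nlinarith
    have k2 : 1 / 2 * ((n : ℝ) - j) ^ 2 ≤ 4 / Real.pi ^ 2 * (2 * Real.pi * n - t) ^ 2 := by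
      rw [div_mul_eq_mul_div (4:ℝ), le_div_iff₀ hπsq]
      have := mul_le_mul_of_nonneg_left hπ10 (by positivity : (0:ℝ) ≤ ((n : ℝ) - j) ^ 2)
      nlinarith
    exact ⟨k1.trans key, Or.inr (k2.trans key)⟩

/-- `Re (z + 2πj) = Re z + 2πj`. [folklore] -/
theorem shiftc_re (z : ℂ) (j : ℕ) : (z + 2 * Real.pi * (j : ℂ)).re = z.re + 2 * Real.pi * j := by
  simp

/-- `Im (z + 2πj) = Im z`. [folklore] -/
theorem shiftc_im (z : ℂ) (j : ℕ) : (z + 2 * Real.pi * (j : ℂ)).im = z.im := by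
  simp

/-- `‖S_ξ(z + 2πj)‖ ≥ 3` and `Re S_ξ(z + 2πj) ≥ 3 − (25/16)(Im z)²`, `1 ≤ j ≤ n-1`, on the fat box. [folklore] -/
theorem norm_Sxi_shift_ge_three (n j : ℕ) (hj : 1 ≤ j) (hjn : j + 1 ≤ n) {z : ℂ} {r : ℝ}
    (hr : r ≤ 1 / 4) (hx : |z.re| ≤ Real.pi + r) :
    3 ≤ ‖Sxi n (z + 2 * Real.pi * (j : ℂ))‖ := by
  have h1 := (shifted_sin_sq_ge n j hj hjn hr hx).1
  have h2 := norm_Sxi_ge_sin n (by omega) (z + 2 * Real.pi * (j : ℂ))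
  rw [shiftc_re] at h2
  linarith

/-- `Re S_ξ(z + 2πj) ≥ 3 − (25/16)(Im z)²` for `1 ≤ j ≤ n−1` on the fat box. [folklore] -/
theorem re_Sxi_shift_ge (n j : ℕ) (hj : 1 ≤ j) (hjn : j + 1 ≤ n) {z : ℂ} {r : ℝ}
    (hr : r ≤ 1 / 4) (hx : |z.re| ≤ Real.pi + r) (hy : |z.im| ≤ 2 * r) :
    3 - 25 / 16 * z.im ^ 2 ≤ (Sxi n (z + 2 * Real.pi * (j : ℂ))).re := by
  have h1 := (shifted_sin_sq_ge n j hj hjn hr hx).1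
  have h2 := re_Sxi_ge n (by omega) (z + 2 * Real.pi * (j : ℂ)) (by rw [shiftc_im]; linarith)
  rw [shiftc_re, shiftc_im] at h2
  linarith

/-- the shifted symbol has no zero on the fat box (`1 ≤ j ≤ n−1`). [folklore] -/
theorem Sxi_shift_ne_zero (n j : ℕ) (hj : 1 ≤ j) (hjn : j + 1 ≤ n) {z : ℂ} {r : ℝ}
    (hr : r ≤ 1 / 4) (hx : |z.re| ≤ Real.pi + r) : Sxi n (z + 2 * Real.pi * (j : ℂ)) ≠ 0 := by
  intro h
  have := norm_Sxi_shift_ge_three n j hj hjn hr hx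
  rw [h, norm_zero] at this
  linarith

/-- quadratic decay in the residue index: `1/‖S_ξ(z+2πj)‖ ≤ 2/(j+1)² + 2/(n-j)²`. [folklore] -/
theorem inv_norm_Sxi_shift_le (n j : ℕ) (hj : 1 ≤ j) (hjn : j + 1 ≤ n) {z : ℂ} {r : ℝ}
    (hr : r ≤ 1 / 4) (hx : |z.re| ≤ Real.pi + r) :
    1 / ‖Sxi n (z + 2 * Real.pi * (j : ℂ))‖ ≤ 2 / ((j : ℝ) + 1) ^ 2 + 2 / ((n : ℝ) - j) ^ 2 := by
  have hjnr : (j : ℝ) + 1 ≤ n := by exact_mod_cast hjn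
  have h2 := norm_Sxi_ge_sin n (by omega) (z + 2 * Real.pi * (j : ℂ))
  rw [shiftc_re] at h2
  have hA : 0 < 1 / 2 * ((j : ℝ) + 1) ^ 2 := by positivity
  have hB : 0 < 1 / 2 * ((n : ℝ) - j) ^ 2 := by
    have : 0 < (n : ℝ) - j := by linarith
    positivity
  have hApos : 0 ≤ 2 / ((j : ℝ) + 1) ^ 2 := by positivity
  have hBpos : 0 ≤ 2 / ((n : ℝ) - j) ^ 2 := by positivity
  rcases (shifted_sin_sq_ge n j hj hjn hr hx).2 with h | h
  · have := one_div_le_one_div_of_le hA (h.trans h2)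
    rw [show 1 / (1 / 2 * ((j : ℝ) + 1) ^ 2) = 2 / ((j : ℝ) + 1) ^ 2 by field_simp] at this
    linarith
  · have := one_div_le_one_div_of_le hB (h.trans h2)
    rw [show 1 / (1 / 2 * ((n : ℝ) - j) ^ 2) = 2 / ((n : ℝ) - j) ^ 2 by field_simp] at this
    linarith

/-- `|u_n(j; z)| ≤ 32/(j+1)² + 32/(n-j)²` for `1 ≤ j ≤ n-1` on the fat box. [folklore] -/
theorem norm_uFactor_ne_le (n j : ℕ) (hj : 1 ≤ j) (hjn : j + 1 ≤ n) {z : ℂ} {r : ℝ}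
    (hr : r ≤ 1 / 4) (hx : |z.re| ≤ Real.pi + r) (hy : |z.im| ≤ 2 * r) :
    ‖uFactor n j z‖ ≤ 32 / ((j : ℝ) + 1) ^ 2 + 32 / ((n : ℝ) - j) ^ 2 := by
  rw [uFactor_ne_eq n j (by omega), norm_div]
  have h1 : ‖S1 z‖ ≤ 16 := norm_S1_le_16 hr hx hy
  have h2 := inv_norm_Sxi_shift_le n j hj hjn hr hx (z := z)
  have hpos : 0 < ‖Sxi n (z + 2 * Real.pi * (j : ℂ))‖ :=
    norm_pos_iff.mpr (Sxi_shift_ne_zero n j hj hjn hr hx)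
  calc ‖S1 z‖ / ‖Sxi n (z + 2 * Real.pi * (j : ℂ))‖
        = ‖S1 z‖ * (1 / ‖Sxi n (z + 2 * Real.pi * (j : ℂ))‖) := by ring
    _ ≤ 16 * (2 / ((j : ℝ) + 1) ^ 2 + 2 / ((n : ℝ) - j) ^ 2) :=
        mul_le_mul h1 h2 (by positivity) (by norm_num)
    _ = 32 / ((j : ℝ) + 1) ^ 2 + 32 / ((n : ℝ) - j) ^ 2 := by ring

/-- `∑_{i<n} 1/(i+1)² ≤ π²/6 ≤ 2` (Mathlib `hasSum_zeta_two`). [folklore] -/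
private theorem sum_inv_sq_le (n : ℕ) : ∑ i ∈ Finset.range n, 1 / ((i : ℝ) + 1) ^ 2 ≤ 2 := by
  have h1 : ∑ i ∈ Finset.range n, 1 / ((i : ℝ) + 1) ^ 2 =
      ∑ i ∈ Finset.range (n + 1), 1 / (i : ℝ) ^ 2 := by
    rw [Finset.sum_range_succ']; simp
  rw [h1]
  have h2 := sum_le_hasSum (Finset.range (n + 1)) (fun i _ => by positivity) hasSum_zeta_two
  have hπ := Real.pi_lt_d2
  have : Real.pi ^ 2 / 6 ≤ 2 := by nlinarith [Real.pi_pos]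
  linarith

/-- reflection `j ↦ n−1−j` of the residue index: `Σ_j 1/(n−j)² = Σ_j 1/(j+1)²`. [folklore] -/
theorem sum_reflect_inv_sq (n : ℕ) :
    ∑ j : Fin n, 1 / ((n : ℝ) - (j : ℕ)) ^ 2 = ∑ j : Fin n, 1 / (((j : ℕ) : ℝ) + 1) ^ 2 := by
  refine Fintype.sum_equiv Fin.revPerm _ _ (fun j => ?_)
  have hj : (j : ℕ) + 1 ≤ n := j.isLt
  rw [Fin.revPerm_apply, Fin.val_rev, Nat.cast_sub hj]
  push_cast
  ring

/-- `S_U`-type bound: `∑_{j ∈ ℤ_n} |u_n(j; z)| ≤ 132` on the fat box, uniformly in `n` (StripLemma.md (A6)). [folklore] -/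
theorem sum_norm_uFactor_le (n : ℕ) [NeZero n] {z : ℂ} {r : ℝ} (hr : r ≤ 1 / 4)
    (hx : |z.re| ≤ Real.pi + r) (hy : |z.im| ≤ 2 * r) :
    ∑ j : Fin n, ‖uFactor n (j : ℕ) z‖ ≤ 132 := by
  have hn : 1 ≤ n := Nat.one_le_iff_ne_zero.mpr (NeZero.ne n)
  have hterm : ∀ j : Fin n, ‖uFactor n (j : ℕ) z‖ ≤
      (if j = 0 then (4:ℝ) else 0) + (32 / (((j : ℕ) : ℝ) + 1) ^ 2 + 32 / ((n : ℝ) - (j : ℕ)) ^ 2) := by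
    intro j
    have hjn : (j : ℕ) + 1 ≤ n := j.isLt
    have hpos : 0 ≤ 32 / (((j : ℕ) : ℝ) + 1) ^ 2 + 32 / ((n : ℝ) - (j : ℕ)) ^ 2 := by
      have : 0 < (n : ℝ) - (j : ℕ) := by
        have : ((j : ℕ) : ℝ) + 1 ≤ n := by exact_mod_cast hjn
        linarith
      positivity
    by_cases hj : j = 0
    · subst hj
      simp only [if_true, Fin.val_zero]
      have := norm_uFactor_zero_le n hn hr hx hy (z := z)
      rw [Fin.val_zero] at hpos
      linarith
    · simp only [hj, if_false, zero_add]
      have hj1 : 1 ≤ (j : ℕ) := Nat.one_le_iff_ne_zero.mpr (fun h => hj (Fin.ext h))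
      exact norm_uFactor_ne_le n j hj1 hjn hr hx hy
  calc ∑ j : Fin n, ‖uFactor n (j : ℕ) z‖
      ≤ ∑ j : Fin n, ((if j = 0 then (4:ℝ) else 0) +
          (32 / (((j : ℕ) : ℝ) + 1) ^ 2 + 32 / ((n : ℝ) - (j : ℕ)) ^ 2)) :=
        Finset.sum_le_sum (fun j _ => hterm j)
    _ = 4 + 64 * ∑ i ∈ Finset.range n, 1 / ((i : ℝ) + 1) ^ 2 := by
        rw [Finset.sum_add_distrib, Finset.sum_add_distrib, Finset.sum_ite_eq' Finset.univ (0 : Fin n),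
          if_pos (Finset.mem_univ _)]
        simp_rw [div_eq_mul_one_div (32:ℝ)]
        rw [← Finset.mul_sum, ← Finset.mul_sum, sum_reflect_inv_sq,
          Fin.sum_univ_eq_sum_range (fun i => 1 / ((i : ℝ) + 1) ^ 2) n]
        ring
    _ ≤ 4 + 64 * 2 := by gcongr; exact sum_inv_sq_le n
    _ = 132 := by norm_num

/-! ### §4 `Δ^ξ`, `u_n` and `E` on the fat region `F_r` (StripLemma.md Lemma A (A6)–(A7): the bound `M_E`) -/

/-- `‖Δ^ξ(q) + m²‖ ≤ 16 d + m²` on `F_r`. [folklore] -/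
theorem norm_DeltaXi_le (n : ℕ) (hn : 1 ≤ n) (m2 : ℝ) (hm : 0 ≤ m2) {r : ℝ} (hr : r ≤ 1 / 4)
    {q : Fin d → ℂ} (hq : q ∈ Fat d r) : ‖DeltaXi n m2 q‖ ≤ 16 * d + m2 := by
  unfold DeltaXi
  calc ‖(∑ μ, Sxi n (q μ)) + (m2 : ℂ)‖
      ≤ ‖∑ μ, Sxi n (q μ)‖ + ‖(m2 : ℂ)‖ := norm_add_le _ _
    _ ≤ (∑ μ, ‖Sxi n (q μ)‖) + m2 := by
        gcongr
        · exact norm_sum_le _ _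
        · rw [Complex.norm_real, Real.norm_eq_abs, abs_of_nonneg hm]
    _ ≤ (∑ _μ : Fin d, (16 : ℝ)) + m2 := by
        gcongr with μ _
        exact norm_Sxi_le_16 n hn hr (hq μ).1 (hq μ).2
    _ = 16 * d + m2 := by simp [mul_comm]

/-- `Re (Δ^ξ(q + 2πk) + m²) ≥ 2` on `F_r` for `k ≠ 0`, when `r ≤ 1/4` and `d r² ≤ 1/16`
(StripLemma.md (A5): the shifted denominators do not vanish on the fat region). [folklore] -/
theorem re_DeltaXi_shift_ge (n : ℕ) [NeZero n] (m2 : ℝ) (hm : 0 ≤ m2) {r : ℝ}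
    (hr : r ≤ 1 / 4) (hdr : (d : ℝ) * r ^ 2 ≤ 1 / 16) {q : Fin d → ℂ} (hq : q ∈ Fat d r)
    (k : Fin d → Fin n) (hk : k ≠ fun _ => 0) :
    2 ≤ (DeltaXi n m2 (shift n k q)).re := by
  have hn : 1 ≤ n := Nat.one_le_iff_ne_zero.mpr (NeZero.ne n)
  obtain ⟨ν₀, hν₀⟩ := Function.ne_iff.mp hk
  simp only [DeltaXi, shift]
  rw [Complex.add_re, Complex.re_sum, Complex.ofReal_re]
  have hlow : ∀ ν, (if ν = ν₀ then (3 : ℝ) else 0) - 25 / 16 * (q ν).im ^ 2 ≤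
      (Sxi n (q ν + 2 * Real.pi * ((k ν : ℕ) : ℂ))).re := by
    intro ν
    have hy : |(q ν).im| ≤ 1 := by linarith [(hq ν).2]
    by_cases hν : ν = ν₀
    · rw [if_pos hν]
      have hkν : (k ν : ℕ) ≠ 0 := by
        intro h; rw [hν] at h; exact hν₀ (Fin.ext h)
      have hj : 1 ≤ (k ν : ℕ) := Nat.one_le_iff_ne_zero.mpr hkν
      have hjn : (k ν : ℕ) + 1 ≤ n := (k ν).isLt
      exact re_Sxi_shift_ge n (k ν : ℕ) hj hjn hr (hq ν).1 (hq ν).2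
    · rw [if_neg hν]
      have base := re_Sxi_ge n hn (q ν + 2 * Real.pi * ((k ν : ℕ) : ℂ)) (by rw [shiftc_im]; exact hy)
      rw [shiftc_re, shiftc_im] at base
      have : 0 ≤ 4 * (n : ℝ) ^ 2 *
          Real.sin (((q ν).re + 2 * Real.pi * ((k ν : ℕ) : ℝ)) / (2 * n)) ^ 2 := by positivity
      linarith
  have hsum := Finset.sum_le_sum (fun ν (_ : ν ∈ Finset.univ) => hlow ν)
  rw [Finset.sum_sub_distrib, Finset.sum_ite_eq' Finset.univ ν₀, if_pos (Finset.mem_univ _),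
    ← Finset.mul_sum] at hsum
  have him2 : ∑ ν, (q ν).im ^ 2 ≤ d * (2 * r) ^ 2 := by
    calc ∑ ν, (q ν).im ^ 2 ≤ ∑ _ν : Fin d, (2 * r) ^ 2 := by
          apply Finset.sum_le_sum; intro ν _
          rw [← sq_abs]; exact pow_le_pow_left₀ (abs_nonneg _) (hq ν).2 2
      _ = d * (2 * r) ^ 2 := by simp
  nlinarith

/-- `‖(Δ^ξ+m²)(q + 2πk)‖ ≥ 2` on `F_r` for `k ≠ 0`. [folklore] -/
theorem norm_DeltaXi_shift_ge (n : ℕ) [NeZero n] (m2 : ℝ) (hm : 0 ≤ m2) {r : ℝ}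
    (hr : r ≤ 1 / 4) (hdr : (d : ℝ) * r ^ 2 ≤ 1 / 16) {q : Fin d → ℂ} (hq : q ∈ Fat d r)
    (k : Fin d → Fin n) (hk : k ≠ fun _ => 0) :
    2 ≤ ‖DeltaXi n m2 (shift n k q)‖ :=
  (re_DeltaXi_shift_ge n m2 hm hr hdr hq k hk).trans (Complex.re_le_norm _)

/-- `‖u_n(k; q)‖ = Π_ν ‖u_n(k_ν; q_ν)‖`. [folklore] -/
theorem norm_U_eq (n : ℕ) (k : Fin d → Fin n) (q : Fin d → ℂ) :
    ‖U n k q‖ = ∏ ν, ‖uFactor n (k ν : ℕ) (q ν)‖ := by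
  unfold U; exact norm_prod _ _

/-- `‖u_n(0; q)‖ ≤ 4^d` on `F_r`. [folklore] -/
theorem norm_U_zero_le (n : ℕ) [NeZero n] {r : ℝ} (hr : r ≤ 1 / 4) {q : Fin d → ℂ}
    (hq : q ∈ Fat d r) : ‖U n (fun _ => (0 : Fin n)) q‖ ≤ 4 ^ d := by
  have hn : 1 ≤ n := Nat.one_le_iff_ne_zero.mpr (NeZero.ne n)
  rw [norm_U_eq]
  calc ∏ ν, ‖uFactor n ((0 : Fin n) : ℕ) (q ν)‖ ≤ ∏ _ν : Fin d, (4 : ℝ) :=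
        Finset.prod_le_prod (fun _ _ => norm_nonneg _)
          (fun ν _ => by rw [Fin.val_zero]; exact norm_uFactor_zero_le n hn hr (hq ν).1 (hq ν).2)
    _ = 4 ^ d := by simp

/-- `∑_k ‖u_n(k; q)‖ ≤ 132^d` on `F_r` (product of the one-coordinate residue sums). [folklore] -/
theorem sum_norm_U_le (n : ℕ) [NeZero n] {r : ℝ} (hr : r ≤ 1 / 4) {q : Fin d → ℂ}
    (hq : q ∈ Fat d r) : ∑ k : Fin d → Fin n, ‖U n k q‖ ≤ 132 ^ d := by
  simp_rw [norm_U_eq]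
  have h := Finset.prod_univ_sum (fun _ : Fin d => (Finset.univ : Finset (Fin n)))
    (fun ν j => ‖uFactor n (j : ℕ) (q ν)‖)
  rw [Fintype.piFinset_univ] at h
  rw [← h]
  calc ∏ ν, ∑ j : Fin n, ‖uFactor n (j : ℕ) (q ν)‖ ≤ ∏ _ν : Fin d, (132 : ℝ) :=
        Finset.prod_le_prod (fun _ _ => Finset.sum_nonneg (fun _ _ => norm_nonneg _))
          (fun ν _ => sum_norm_uFactor_le n hr (hq ν).1 (hq ν).2)
    _ = 132 ^ d := by simp

/-- The uniform bound `M_E` of StripLemma.md (A7), with this file's constants. [folklore] -/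
def boundM (d : ℕ) (A mplus : ℝ) : ℝ :=
  (16 * d + |mplus|) + A * 4 ^ d + A * ((16 * d + |mplus|) / 2 * 132 ^ d)

/-- `M_E ≥ 0`. [folklore] -/
theorem boundM_nonneg (d : ℕ) {A : ℝ} (hA : 0 ≤ A) (mplus : ℝ) : 0 ≤ boundM d A mplus := by
  unfold boundM; positivity

/-- `M_E` is monotone in the coupling bound `A`. [folklore] -/
theorem boundM_mono (d : ℕ) {A A' : ℝ} (hA' : A ≤ A') (mplus : ℝ) :
    boundM d A mplus ≤ boundM d A' mplus := by
  unfold boundM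
  have h1 : (0:ℝ) ≤ 4 ^ d := by positivity
  have h2 : (0:ℝ) ≤ (16 * d + |mplus|) / 2 * 132 ^ d := by positivity
  nlinarith [mul_le_mul_of_nonneg_right hA' h1, mul_le_mul_of_nonneg_right hA' h2]

/-- **Lemma A (A7)**: `‖E(q)‖ ≤ M_E` on the fat region, uniformly in `n ≥ 1`,
`0 ≤ m² ≤ m²₊`. [folklore] -/
theorem norm_E_le (n : ℕ) [NeZero n] (a m2 mplus : ℝ) (hm : 0 ≤ m2) (hmp : m2 ≤ mplus) {r : ℝ}
    (hr : r ≤ 1 / 4) (hdr : (d : ℝ) * r ^ 2 ≤ 1 / 16) {q : Fin d → ℂ} (hq : q ∈ Fat d r) :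
    ‖E n a m2 q‖ ≤ boundM d |a| mplus := by
  have hn : 1 ≤ n := Nat.one_le_iff_ne_zero.mpr (NeZero.ne n)
  have hmp' : m2 ≤ |mplus| := hmp.trans (le_abs_self _)
  set D := (16 : ℝ) * d + |mplus| with hDdef
  have hD : ‖DeltaXi n m2 q‖ ≤ D := (norm_DeltaXi_le n hn m2 hm hr hq).trans (by linarith)
  have hD0 : 0 ≤ D := by positivity
  have hU0 := norm_U_zero_le n hr hq
  have hterm : ∀ k ∈ (Finset.univ.erase (fun _ => (0 : Fin n))),
      ‖U n k q * (DeltaXi n m2 q / DeltaXi n m2 (shift n k q))‖ ≤ ‖U n k q‖ * (D / 2) := by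
    intro k hk
    have hk0 : k ≠ fun _ => 0 := Finset.ne_of_mem_erase hk
    have h2 : 2 ≤ ‖DeltaXi n m2 (shift n k q)‖ := norm_DeltaXi_shift_ge n m2 hm hr hdr hq k hk0
    rw [norm_mul, norm_div]
    apply mul_le_mul_of_nonneg_left _ (norm_nonneg _)
    rw [div_le_div_iff₀ (by linarith) (by norm_num)]
    nlinarith [norm_nonneg (DeltaXi n m2 q)]
  have hsum : ‖∑ k ∈ Finset.univ.erase (fun _ => (0 : Fin n)),
      U n k q * (DeltaXi n m2 q / DeltaXi n m2 (shift n k q))‖ ≤ 132 ^ d * (D / 2) := by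
    calc ‖∑ k ∈ Finset.univ.erase (fun _ => (0 : Fin n)),
          U n k q * (DeltaXi n m2 q / DeltaXi n m2 (shift n k q))‖
        ≤ ∑ k ∈ Finset.univ.erase (fun _ => (0 : Fin n)),
          ‖U n k q * (DeltaXi n m2 q / DeltaXi n m2 (shift n k q))‖ := norm_sum_le _ _
      _ ≤ ∑ k ∈ Finset.univ.erase (fun _ => (0 : Fin n)), ‖U n k q‖ * (D / 2) :=
          Finset.sum_le_sum hterm
      _ ≤ ∑ k : Fin d → Fin n, ‖U n k q‖ * (D / 2) :=
          Finset.sum_le_sum_of_subset_of_nonneg (Finset.erase_subset _ _)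
            (fun k _ _ => by positivity)
      _ = (∑ k : Fin d → Fin n, ‖U n k q‖) * (D / 2) := by rw [Finset.sum_mul]
      _ ≤ 132 ^ d * (D / 2) := by gcongr; exact sum_norm_U_le n hr hq
  unfold E
  calc ‖DeltaXi n m2 q + (a : ℂ) * U n (fun _ => (0 : Fin n)) q +
        (a : ℂ) * ∑ k ∈ Finset.univ.erase (fun _ => (0 : Fin n)),
          U n k q * (DeltaXi n m2 q / DeltaXi n m2 (shift n k q))‖
      ≤ ‖DeltaXi n m2 q‖ + ‖(a : ℂ) * U n (fun _ => (0 : Fin n)) q‖ +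
        ‖(a : ℂ) * ∑ k ∈ Finset.univ.erase (fun _ => (0 : Fin n)),
          U n k q * (DeltaXi n m2 q / DeltaXi n m2 (shift n k q))‖ := norm_add₃_le
    _ ≤ D + |a| * 4 ^ d + |a| * (D / 2 * 132 ^ d) := by
        rw [norm_mul, norm_mul, Complex.norm_real, Real.norm_eq_abs]
        gcongr
        linarith
    _ = boundM d |a| mplus := by simp [boundM, hDdef]


/-! ### §5 Slice-holomorphy of `E` on the fat region (hypothesis (H1) of Lemma C; StripLemma.md (A3)/(A5):
every singularity of the printed factors lies off `F_r`, cf. `B4Strip.printed_factor_has_poles`) -/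

/-- `S₁` is entire. [folklore] -/
theorem differentiable_S1 : Differentiable ℂ S1 := by
  unfold S1; fun_prop

/-- `S_ξ` is entire. [folklore] -/
theorem differentiable_Sxi (n : ℕ) : Differentiable ℂ (Sxi n) := by
  unfold Sxi; fun_prop

/-- the Chebyshev closed form `U_{n-1}(cos(z/2n))² / n²` of the filled factor `ρ_n` (removable singularity at `0`). [folklore] -/
def cheb (n : ℕ) (z : ℂ) : ℂ :=
  ((Polynomial.Chebyshev.U ℂ ((n : ℤ) - 1)).eval (Complex.cos (z / (2 * n)))) ^ 2 / (n : ℂ) ^ 2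

/-- the Chebyshev form is entire. [folklore] -/
theorem differentiable_cheb (n : ℕ) : Differentiable ℂ (cheb n) := by
  have h1 : Differentiable ℂ (fun z : ℂ => Complex.cos (z / (2 * n))) := by fun_prop
  have h2 : Differentiable ℂ (fun z : ℂ =>
      (Polynomial.Chebyshev.U ℂ ((n : ℤ) - 1)).eval (Complex.cos (z / (2 * n)))) :=
    (Polynomial.differentiable (Polynomial.Chebyshev.U ℂ ((n : ℤ) - 1))).comp h1
  unfold cheb
  exact (h2.fun_pow 2).div_const _

/-- `sin(z/2) = U_{n-1}(cos(z/2n)) · sin(z/2n)` (Mathlib `Polynomial.Chebyshev.U_complex_cos`). [folklore] -/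
theorem sin_half_eq_cheb (n : ℕ) (hn : n ≠ 0) (z : ℂ) :
    Complex.sin (z / 2) = (Polynomial.Chebyshev.U ℂ ((n : ℤ) - 1)).eval (Complex.cos (z / (2 * n))) *
      Complex.sin (z / (2 * n)) := by
  have hn' : (n : ℂ) ≠ 0 := Nat.cast_ne_zero.mpr hn
  rw [Polynomial.Chebyshev.U_complex_cos]
  congr 1
  push_cast
  field_simp
  ring

/-- on `|Re z| < 2π` the filled factor IS the Chebyshev form (so it is holomorphic there). [folklore] -/
theorem uFactor_zero_eq_cheb (n : ℕ) (hn : 1 ≤ n) {z : ℂ} (hx : |z.re| < 2 * Real.pi) :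
    uFactor n 0 z = cheb n z := by
  have hn0 : n ≠ 0 := by omega
  have hn' : (n : ℂ) ≠ 0 := Nat.cast_ne_zero.mpr hn0
  have hnr : (0 : ℝ) < n := by exact_mod_cast Nat.pos_of_ne_zero hn0
  rw [uFactor_zero_eq]
  split_ifs with hz
  · subst hz
    unfold cheb
    rw [zero_div, Complex.cos_zero, Polynomial.Chebyshev.U_eval_one]
    push_cast
    field_simp
    ring
  · have hs : Complex.sin (z / (2 * n)) ≠ 0 := by
      apply sin_ne_zero_of_abs_re_lt
      · rw [re_div_two_nat, abs_div, abs_of_pos (by positivity : (0:ℝ) < 2 * n),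
          div_lt_iff₀ (by positivity)]
        have : (1:ℝ) ≤ n := by exact_mod_cast hn
        nlinarith [Real.pi_pos, abs_nonneg z.re]
      · intro h; apply hz
        have : z = (z / (2 * n)) * (2 * n) := by field_simp
        rw [this, h, zero_mul]
    unfold cheb
    rw [S1_eq_Sxi_one, Sxi_eq_sin_sq 1 one_ne_zero, Sxi_eq_sin_sq n hn0]
    have e1 : z / (2 * ((1 : ℕ) : ℂ)) = z / 2 := by push_cast; ring
    rw [e1, sin_half_eq_cheb n hn0 z]
    field_simp
    ring

/-- the filled factor `ρ_n` is holomorphic at every `z` with `|Re z| < 2π` (removable singularity at `0`). [folklore] -/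
theorem differentiableAt_uFactor_zero (n : ℕ) (hn : 1 ≤ n) {z : ℂ} (hx : |z.re| < 2 * Real.pi) :
    DifferentiableAt ℂ (uFactor n 0) z := by
  have hO : IsOpen {w : ℂ | |w.re| < 2 * Real.pi} :=
    isOpen_lt (continuous_abs.comp Complex.continuous_re) continuous_const
  have hev : uFactor n 0 =ᶠ[nhds z] cheb n :=
    Filter.eventuallyEq_of_mem (hO.mem_nhds hx) (fun w hw => uFactor_zero_eq_cheb n hn hw)
  exact (differentiable_cheb n z).congr_of_eventuallyEq hev

/-- the shifted factor `u_n(j;·)`, `j ≠ 0`, is holomorphic wherever its denominator `S_ξ(· + 2πj)` is nonzero. [folklore] -/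
theorem differentiableAt_uFactor_ne (n j : ℕ) (hj : j ≠ 0) {z : ℂ}
    (h : Sxi n (z + 2 * Real.pi * (j : ℂ)) ≠ 0) : DifferentiableAt ℂ (uFactor n j) z := by
  have e : uFactor n j = fun w => S1 w / Sxi n (w + 2 * Real.pi * (j : ℂ)) := by
    funext w; simp [uFactor, hj]
  rw [e]
  apply DifferentiableAt.fun_div
  · exact differentiable_S1 z
  · exact ((differentiable_Sxi n).comp (differentiable_id.add_const _)) z
  · exact h

/-- each coordinate of `w ↦ update q μ w` is an entire function of `w` (identity or constant). [folklore] -/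
theorem differentiable_update_apply (q : Fin d → ℂ) (μ ν : Fin d) :
    Differentiable ℂ (fun w : ℂ => Function.update q μ w ν) := by
  by_cases h : ν = μ
  · subst h; simp only [Function.update_self]; exact differentiable_id
  · simp only [Function.update_of_ne h]; exact differentiable_const _

/-- **Lemma A (H1)**: every coordinate slice of `E` through a point of the fat region is holomorphic there
(uniformly in `n ≥ 1`; needs `r ≤ 1/4`, `d r² ≤ 1/16` for the shifted denominators). [folklore] -/
theorem differentiableAt_E_slice (n : ℕ) [NeZero n] (a m2 : ℝ) (hm : 0 ≤ m2) {r : ℝ}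
    (hr : r ≤ 1 / 4) (hdr : (d : ℝ) * r ^ 2 ≤ 1 / 16) {q : Fin d → ℂ} (hq : q ∈ Fat d r)
    (μ : Fin d) : DifferentiableAt ℂ (fun w => E n a m2 (Function.update q μ w)) (q μ) := by
  have hn : 1 ≤ n := Nat.one_le_iff_ne_zero.mpr (NeZero.ne n)
  have hπ := Real.pi_gt_three
  have hcoord : ∀ ν, Differentiable ℂ (fun w : ℂ => Function.update q μ w ν) :=
    differentiable_update_apply q μ
  have hat : ∀ ν, Function.update q μ (q μ) ν = q ν := by
    intro ν; rw [Function.update_eq_self]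
  have hΔ : DifferentiableAt ℂ (fun w => DeltaXi n m2 (Function.update q μ w)) (q μ) := by
    simp only [DeltaXi]
    apply DifferentiableAt.add_const
    apply DifferentiableAt.fun_sum
    intro ν _
    exact ((differentiable_Sxi n).comp (hcoord ν)) (q μ)
  have hΔk : ∀ k : Fin d → Fin n, DifferentiableAt ℂ
      (fun w => DeltaXi n m2 (shift n k (Function.update q μ w))) (q μ) := by
    intro k
    simp only [DeltaXi, shift]
    apply DifferentiableAt.add_const
    apply DifferentiableAt.fun_sum
    intro ν _
    exact ((differentiable_Sxi n).comp ((hcoord ν).add_const _)) (q μ)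
  have hU : ∀ k : Fin d → Fin n,
      DifferentiableAt ℂ (fun w => U n k (Function.update q μ w)) (q μ) := by
    intro k
    simp only [U]
    apply DifferentiableAt.fun_finsetProd
    intro ν _
    have hF : DifferentiableAt ℂ (uFactor n (k ν : ℕ)) (Function.update q μ (q μ) ν) := by
      rw [hat ν]
      by_cases hk : (k ν : ℕ) = 0
      · rw [hk]
        exact differentiableAt_uFactor_zero n hn (by linarith [(hq ν).1, hr])
      · exact differentiableAt_uFactor_ne n _ hk
          (Sxi_shift_ne_zero n _ (Nat.one_le_iff_ne_zero.mpr hk) (k ν).isLt hr (hq ν).1)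
    exact hF.comp (q μ) ((hcoord ν) (q μ))
  have hne : ∀ k ∈ Finset.univ.erase (fun _ => (0 : Fin n)),
      DeltaXi n m2 (shift n k (Function.update q μ (q μ))) ≠ 0 := by
    intro k hk h
    rw [Function.update_eq_self] at h
    have := re_DeltaXi_shift_ge n m2 hm hr hdr hq k (Finset.ne_of_mem_erase hk)
    rw [h, Complex.zero_re] at this
    linarith
  simp only [E]
  apply DifferentiableAt.fun_add
  · apply DifferentiableAt.fun_add hΔ
    exact (hU _).const_mul _
  · apply DifferentiableAt.const_mul
    apply DifferentiableAt.fun_sum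
    intro k hk
    exact (hU k).fun_mul (hΔ.fun_div (hΔk k) (hne k hk))

/-! ### §6 The constants `r`, `Λ` and the theorems -/

/-- the coordinate-disc radius `r = 1/(4(d+1))` (so `r ≤ 1/4`, `d r² ≤ 1/16`). [folklore] -/
def rOf (d : ℕ) : ℝ := 1 / (4 * ((d : ℝ) + 1))

/-- `r > 0`. [folklore] -/
theorem rOf_pos (d : ℕ) : 0 < rOf d := by unfold rOf; positivity

/-- `r ≤ 1/4`. [folklore] -/
theorem rOf_le (d : ℕ) : rOf d ≤ 1 / 4 := by
  unfold rOf
  have : (0:ℝ) ≤ d := Nat.cast_nonneg d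
  rw [div_le_div_iff₀ (by positivity) (by norm_num)]
  linarith

/-- `d r² ≤ 1/16`. [folklore] -/
theorem d_mul_rOf_sq_le (d : ℕ) : (d : ℝ) * rOf d ^ 2 ≤ 1 / 16 := by
  unfold rOf
  have hd : (0:ℝ) ≤ d := Nat.cast_nonneg d
  rw [div_pow, one_pow, mul_one_div, div_le_div_iff₀ (by positivity) (by norm_num)]
  nlinarith

/-- the Lipschitz constant `Λ = M_E / r` of Lemma C. [folklore] -/
def LambdaOf (d : ℕ) (aminus aplus m2plus : ℝ) : ℝ :=
  boundM d (max |aminus| |aplus|) m2plus / rOf d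

/-- **Theorem (gap G-B4-02a closed in the kernel).** `B4Strip.UniformImLipschitz` HOLDS, with
`r = 1/(4(d+1))` and `Λ = M_E / r`: slice-holomorphy (§5) and the bound `M_E` (§4) on the fat region are fed into the
abstract Cauchy-estimate / segment / telescoping lemma `imLipschitz_of_fat` (§1). No hypothesis on `aminus, aplus,
m2plus` is needed (an empty window is vacuous). [folklore] -/
theorem uniformImLipschitz_holds (d : ℕ) (aminus aplus m2plus : ℝ) :
    UniformImLipschitz d aminus aplus m2plus (rOf d) (LambdaOf d aminus aplus m2plus) := by
  unfold UniformImLipschitz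
  refine ⟨rOf_pos d, ?_, ?_⟩
  · unfold LambdaOf
    exact div_nonneg (boundM_nonneg d (le_max_of_le_left (abs_nonneg _)) m2plus) (rOf_pos d).le
  · intro n _ a m2 κ ha1 ha2 hm1 hm2 hκ hκr
    have hA : |a| ≤ max |aminus| |aplus| := abs_le_max_abs_abs ha1 ha2
    have hbound : ∀ q ∈ Fat d (rOf d), ‖E n a m2 q‖ ≤ boundM d (max |aminus| |aplus|) m2plus :=
      fun q hq => (norm_E_le n a m2 m2plus hm1 hm2 (rOf_le d) (d_mul_rOf_sq_le d) hq).trans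
        (boundM_mono d hA m2plus)
    have hdiff : ∀ q ∈ Fat d (rOf d), ∀ μ,
        DifferentiableAt ℂ (fun w => E n a m2 (Function.update q μ w)) (q μ) :=
      fun q hq μ => differentiableAt_E_slice n a m2 hm1 (rOf_le d) (d_mul_rOf_sq_le d) hq μ
    unfold ImLipschitz LambdaOf
    exact imLipschitz_of_fat (E n a m2) (rOf_pos d) hκ.le hκr hdiff hbound

/-- **Corollary (gap G-B4-02c made unconditional).** The UNIFORM STRIP BOUND asserted on p. 586 —
`|E(p')| ≥ c > 0` for `|Im p'_μ| ≤ κ`, with `κ, c` depending only on `d`, `0 < a₋ ≤ a ≤ a₊`, `0 ≤ m² ≤ m²₊` and NOT on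
`n` — is now a THEOREM (`B4Strip.uniformStrip_of_uniformImLipschitz` applied to `uniformImLipschitz_holds`). [folklore] -/
theorem uniformStrip_holds (d : ℕ) (aminus aplus m2plus : ℝ) (ha : 0 < aminus) :
    UniformStrip d aminus aplus m2plus :=
  uniformStrip_of_uniformImLipschitz d aminus aplus m2plus (rOf d) (LambdaOf d aminus aplus m2plus) ha
    (uniformImLipschitz_holds d aminus aplus m2plus)

/-- **Explicit constants** (same proof as `B4Strip.uniformStrip_of_uniformImLipschitz`, constants exposed):
with `c = a₋(4/π²)^d/2`, `Λ = M_E/r`, `κ₀ = min(r, c/(Λd+1))` one has `κ₀ > 0` and `|E(p′)| ≥ c` on the strip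
`|Im p′_μ| ≤ κ₀`, for all `n ≥ 1`, `a₋ ≤ a ≤ a₊`, `0 ≤ m² ≤ m²₊`. [folklore] -/
theorem uniformStrip_explicit (d : ℕ) (aminus aplus m2plus : ℝ) (ha : 0 < aminus) :
    0 < min (rOf d) (aminus * (4 / Real.pi ^ 2) ^ d / 2 / (LambdaOf d aminus aplus m2plus * d + 1)) ∧
    ∀ (n : ℕ) [NeZero n] (a m2 : ℝ), aminus ≤ a → a ≤ aplus → 0 ≤ m2 → m2 ≤ m2plus →
      ∀ p ∈ Strip d (min (rOf d) (aminus * (4 / Real.pi ^ 2) ^ d / 2 / (LambdaOf d aminus aplus m2plus * d + 1))),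
        aminus * (4 / Real.pi ^ 2) ^ d / 2 ≤ ‖E n a m2 p‖ := by
  obtain ⟨hr, hΛ, hlip⟩ := uniformImLipschitz_holds d aminus aplus m2plus
  set Λ := LambdaOf d aminus aplus m2plus with hΛdef
  set r := rOf d with hrdef
  set c : ℝ := aminus * (4 / Real.pi ^ 2) ^ d / 2 with hc
  have hcpos : 0 < c := by positivity
  have hden : 0 < Λ * d + 1 := by positivity
  set κ := min r (c / (Λ * d + 1)) with hκ
  have hκpos : 0 < κ := lt_min hr (div_pos hcpos hden)
  refine ⟨hκpos, ?_⟩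
  intro n _ a m2 ha1 ha2 hm1 hm2 p hp
  have hn : 1 ≤ n := Nat.one_le_iff_ne_zero.mpr (NeZero.ne n)
  have ha0 : 0 ≤ a := le_trans ha.le ha1
  have hκr : κ ≤ r := min_le_left _ _
  have hL : ImLipschitz d n a m2 κ Λ := hlip n a m2 κ ha1 ha2 hm1 hm2 hκpos hκr
  have hsmall' : Λ * (d * κ) ≤ c := by
    have h1 : κ ≤ c / (Λ * d + 1) := min_le_right _ _
    have h2 : Λ * d * κ ≤ Λ * d * (c / (Λ * d + 1)) :=
      mul_le_mul_of_nonneg_left h1 (by positivity)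
    have h3 : Λ * d * (c / (Λ * d + 1)) ≤ c := by
      rw [mul_div_assoc', div_le_iff₀ hden]
      nlinarith
    calc Λ * (d * κ) = Λ * d * κ := by ring
      _ ≤ c := h2.trans h3
  have hca : c ≤ a * (4 / Real.pi ^ 2) ^ d / 2 := by
    rw [hc]
    have : (0:ℝ) ≤ (4 / Real.pi ^ 2) ^ d / 2 := by positivity
    nlinarith
  have hsmall : Λ * (d * κ) ≤ a * (4 / Real.pi ^ 2) ^ d / 2 := hsmall'.trans hca
  exact hca.trans (E_lower_of_ImLipschitz n hn a m2 κ Λ ha0 hm1 hΛ hL hsmall p hp)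

end

end Literature.MathematicalPhysics.QuantumFieldTheory.Balaban1983to89.B4StripCauchy
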